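import Summits.HubbardSuperconductivity.HubbardLadder.Bounds.SpinCorrelationEtaLineEuclid
import Literature.MathematicalPhysics.QuantumLattice.HubbardMultiFermionDecaySharp
import Mathlib.Order.LiminfLimsup
import HarnessLib
import HarnessLib.Audit

/-!
# Hubbard ladder — Bounds: the sharp Koma–Tasaki `η`-line for EVERY `n`-fermion pairing
# operator (footnote [10]): `η_n(T) ≥ n²T/(4π|t|)`; quartets (charge `4e`): `η₄ ≥ 4T/(π|t|)`,
# machine-checked (bounds.tex Thm 10⁵; nearest-neighbour AND `t–t'` class)

HONEST FRAMING (cell pub-hubbard): ladder R1–R4 with certified numbers; no claim on H/H₀. These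
are bounds for a MODEL CLASS — the grand-canonical Hubbard model `hubbardTorusWith 2 L t U μ` and
the `t–t'` model `hubbardTorusTT' L t t' U - μN` on the square torus `(ℤ/Lℤ)²` (every `L ≥ 1`,
all real `t, t', U, μ`, every `β > 0`); no materials claim. Companion text:
`pub-hubbard/paper/bounds.tex` §Theorem 10 (Thm 10⁵); tables
`pub-hubbard/pub-hubbard-bounds/BOUNDS.md` (row T8¹⁰) and `EXTREMISERS.md` §5l.

## Content

Koma–Tasaki, PRL 68 (1992) 3248, footnote [10]: the Theorem extends to the general pairing
operators `P_x = c_{x+δ₁,σ₁} c_{x+δ₂,σ₂} ⋯ c_{x+δ_n,σ_n}` ("this allows us to rule out the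
condensation of various types of electron pairings"), without constants. The new Literature file
`HubbardMultiFermionDecaySharp` (this seat) makes it explicit and sharp: an `n`-fermion product
carries gauge charge exactly `n` under a flat site gauge (`siteGauge_mul_fermionProduct_mul`), so
with the printed hopping norm and the flat Euclidean truncated logarithmic dipole
(`norm_thermalCorr_multiFermion_le_sharp`): for steps `δ_i, δ'_i ∈ {0, ±e₁, ±e₂}`, arbitrary
spins, every `q ≥ 0` with `f := 2nq - 4πβ|t|q² ≥ 0`, uniformly in `L`, all `U`, `μ`,
`|⟨(P_x)† P'_y⟩_{β,L}| ≤ K(q) 5^f (dist(x,y)+1)^{-f}`, `K(q) = exp[2β|t|(2πq²+76q²+544q⁴e^{2q²})]`,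
optimum `q* = n/(4πβ|t|)`, `f* = n²/(4πβ|t|) = n²T/(4π|t|)`: `n = 1` is the one-particle exponent
`T/(4π|t|)` (`GreenDecaySharp`), `n = 2` the pair exponent `T/(π|t|)` (`PairEtaLineSharp`,
`PairFieldEtaLineSharp`), `n = 4` — electron QUARTETS, charge `4e` — the exponent `4T/(π|t|)`.
Proved here (ladder nodes):

* `MultiFermionEtaLineEuclid` / `_holds` — torus-uniform form: `β|t| < n²/π`
  (`T > π|t|/n²`) ⟹ `∃ f > 1/4, C`: `|⟨(P_x)† P'_y⟩_{β,L}| ≤ C (dist+1)^{-f}` for all `L, x, y`;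
* `MultiFermionEtaLineSharp` / `_holds` — thermodynamic-limit form, `n ≥ 1`, `t ≠ 0`: for every
  `ε > 0` and `|z| ≥ R(ε)`, `limsup_{L→∞} |⟨(P_0)† P'_z⟩_{β,L+1}| ≤ |z|^{-(1-ε)n²/(4πβ|t|)}`;
* `MultiFermionEtaLineEuclidTPrime`, `MultiFermionEtaLineSharpTPrime` (+ `_holds`) — the same
  for the `t–t'` model with `|t|` replaced by `|t| + 2|t'|`
  (`norm_thermalCorr_multiFermion_ttPrime_le_sharp`);
* `bondQuartet_decay_torus`, `bondQuartet_limsup_le_rpow` (+ `_ttPrime`) — the statements for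
  the bond quartet `Q_x = c_{x↑} c_{x↓} c_{x+e₁,↑} c_{x+e₁,↓}` (two on-site pairs on a bond,
  charge `4e`): `η₄(T) ≥ 4T/(π|t|)`; `η₄ > 1/4` for every `T > π|t|/16 ≈ 0.196|t|`
  (`t–t'`: `T > (π/16)(|t|+2|t'|)`, `= 0.275|t|` at `t' = -0.2t`), every `U`, `μ`.

Reading (bounds.tex Cor 10.4): at a BKT transition of a charge-`ne` condensate the condensing
field has `η = 1/4` (Nelson–Kosterlitz); read for the `n`-fermion field, a quasi-long-range
order of `n`-electron bound states with `η ≤ 1/4` can only occur at `T ≤ π|t|/n²`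
(`t–t'`: `(π/n²)(|t|+2|t'|)`), whatever `U` and the filling: `0.785|t|` for pairs, `0.196|t|`
for quartets (charge `4e`, Berg–Fradkin–Kivelson 2009), `0.087|t|` for sextets; unconditional,
machine-checked. NOT claimed: optimality within the method; anything below the lines; any LOWER
bound; operators with steps outside `{0, ±e₁, ±e₂}` (same exponent, larger constant — the flat
region of the dipole would have to be enlarged; not done).

References (keys of `lean/references.bib`): KomaTasakiPRL1992 (Theorem, eqs. (5)–(13), note 9,
footnote [10]); McBryanSpencer1977; NelsonKosterlitz1977; XuEtAl2024 eq. (1);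
FriedliVelenikSMLS2017 Thm 9.12. Charge-`4e` context: E. Berg, E. Fradkin, S. A. Kivelson,
Nature Phys. 5 (2009) 830.
-/

noncomputable section

namespace Summit.HubbardSuperconductivity.HubbardLadder.Bounds

open Matrix Finset NormedSpace
open Literature.MathematicalPhysics.QuantumLattice Literature.Probability.LatticeModels
  Literature.Barriers.HubbardSuperconductivity
open scoped Matrix.Norms.L2Operator ComplexOrder

/-! ### The `η = 1/4` line for `n`-fermion operators, torus-uniform form -/

/-- `β b < n²/π` with `b ≥ 0` forces `n ≥ 1`. -/
private theorem one_le_of_lt_sq_div {n : ℕ} {b : ℝ} (hb0 : 0 ≤ b)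
    (hb : b < (n : ℝ) ^ 2 / Real.pi) : (1 : ℝ) ≤ n := by
  have hn2 : (0 : ℝ) < (n : ℝ) ^ 2 / Real.pi := lt_of_le_of_lt hb0 hb
  have hn0 : n ≠ 0 := by
    rintro rfl
    simp at hn2
  exact_mod_cast Nat.one_le_iff_ne_zero.2 hn0

/-- From `b < n²/π`, `b ≥ 0`, `n ≥ 1`: an explicit `q ≥ 0` with `f = 2nq - 4πbq² > 1/4`
(`q = 1/4` if `4πb ≤ n`, else `q = n/(4πb)` with `f = n²/(4πb)`). -/
private theorem exists_exponent_gt_quarter {n : ℕ} {b : ℝ} (hb0 : 0 ≤ b)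
    (hb : b < (n : ℝ) ^ 2 / Real.pi) :
    ∃ q : ℝ, 0 ≤ q ∧ 1 / 4 < 2 * n * q - 4 * Real.pi * b * q ^ 2 := by
  have hπ := Real.pi_pos
  have hn : (1 : ℝ) ≤ n := one_le_of_lt_sq_div hb0 hb
  have hbn : Real.pi * b < (n : ℝ) ^ 2 := by
    have := (lt_div_iff₀ hπ).1 hb
    linarith
  by_cases hc : 4 * Real.pi * b ≤ n
  · refine ⟨1 / 4, by norm_num, ?_⟩
    nlinarith
  · have hc' : (n : ℝ) < 4 * Real.pi * b := not_le.1 hc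
    have hb1 : 0 < b := by
      rcases hb0.eq_or_lt with h | h
      · rw [← h, mul_zero] at hc'; linarith
      · exact h
    refine ⟨n / (4 * Real.pi * b), by positivity, ?_⟩
    have hfval : 2 * (n : ℝ) * (n / (4 * Real.pi * b)) -
        4 * Real.pi * b * (n / (4 * Real.pi * b)) ^ 2 = (n : ℝ) ^ 2 / (4 * Real.pi * b) := by
      field_simp
      ring
    rw [hfval, div_lt_div_iff₀ (by norm_num) (by positivity)]
    nlinarith

/-- **Cor 10.4 (torus form, every `n`-fermion pairing operator; PROVED below).** Grand-canonical
Hubbard model `H = H_Λ(t,U) - μN` on `(ℤ/Lℤ)²`; `P_x = c_{x+δ₁,σ₁} ⋯ c_{x+δ_n,σ_n}`,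
`P'_y = c_{y+δ'₁,σ'₁} ⋯ c_{y+δ'_n,σ'_n}` with steps in `{0, ±e₁, ±e₂}` and arbitrary spins
(`multiFermion`); any real `t, U, μ`, `β > 0` with `β|t| < n²/π` (temperature `T > π|t|/n²`:
`0.785|t|` for pairs, `0.196|t|` for quartets): there are `f > 1/4` and `C` with
`|⟨(P_x)† P'_y⟩_{β,L}| ≤ C (dist(x,y)+1)^{-f}` for all `L, x, y` — no `n`-electron
quasi-long-range order with `η ≤ 1/4` there, whatever `U`, `μ`. kind: support (PROVED).
Why it might fail: it cannot (proved); NOT claimed: optimality of the exponent within the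
method, any lower bound, steps outside `{0, ±e₁, ±e₂}`. Sources: KomaTasakiPRL1992 Theorem,
eqs. (5)–(13), footnote [10]; McBryanSpencer1977; NelsonKosterlitz1977; this cell bounds.tex
Thm 10⁵. -/
@[conjecture] def MultiFermionEtaLineEuclid : Prop :=
  ∀ (n : ℕ) (δ δ' : Fin n → Site 2) (σ σ' : Fin n → Fin 2),
    (∀ i, δ i ∈ insert (0 : Site 2) unitSteps) → (∀ i, δ' i ∈ insert (0 : Site 2) unitSteps) →
    ∀ (t U μ β : ℝ), 0 < β → β * |t| < (n : ℝ) ^ 2 / Real.pi →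
    ∃ f C : ℝ, 1 / 4 < f ∧ ∀ (L : ℕ) [NeZero L] (x y : TorusSite 2 L),
      ‖(hubbardTorusWith 2 L t U μ).thermalCorr β
          (multiFermion δ σ L x)ᴴ (multiFermion δ' σ' L y)‖ ≤
        C * ((torusDist x y : ℝ) + 1) ^ (-f)

/-- **`MultiFermionEtaLineEuclid` holds** (`b = β|t|`; witness `q` of
`exists_exponent_gt_quarter`, `C = K(q) 5^f`). -/
theorem multiFermionEtaLineEuclid_holds : MultiFermionEtaLineEuclid := by
  intro n δ δ' σ σ' hδ hδ' t U μ β hβ hb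
  have hb0 : 0 ≤ β * |t| := by positivity
  obtain ⟨q, hq0, hf4⟩ := exists_exponent_gt_quarter hb0 hb
  refine ⟨2 * n * q - 4 * Real.pi * (β * |t|) * q ^ 2,
    Real.exp (2 * (β * |t|) *
        (2 * Real.pi * q ^ 2 + 76 * q ^ 2 + 544 * q ^ 4 * Real.exp (2 * q ^ 2))) *
      (5 : ℝ) ^ (2 * n * q - 4 * Real.pi * (β * |t|) * q ^ 2), hf4, fun L _ x y => ?_⟩
  rw [mul_assoc]
  exact norm_thermalCorr_multiFermion_le_sharp L δ δ' σ σ' hδ hδ' t U μ β q hβ.le hq0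
    (by linarith) x y

/-! ### The sharp exponent `η_n(T) ≥ n²T/(4π|t|)`, thermodynamic-limit form -/

/-- **Thm 10⁵ (the sharp Koma–Tasaki exponent for `n`-fermion pairing operators; PROVED
below).** For `n ≥ 1`, steps in `{0, ±e₁, ±e₂}`, arbitrary spins, all real `U, μ`, `t ≠ 0`,
`β > 0` and `ε > 0` there is `R` such that for every `z ∈ ℤ²` with `|z| ≥ R`,
`limsup_{L→∞} |⟨(P_0)† P'_z⟩_{β,L+1}| ≤ |z|^{-(1-ε)n²/(4πβ|t|)}` — the `n`-fermion correlations
of the 2D Hubbard model decay at least as fast as `|z|^{-η}` with `η = n²T/(4π|t|)`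
(McBryan–Spencer's exponent for the charge-`n` observable `e^{inθ}` of the plane rotator, with
Koma–Tasaki's printed hopping norm). kind: support (PROVED). Why it might fail: it cannot
(proved); the `limsup` form sidesteps the (unformalised) infinite-volume Gibbs state exactly as
`PairEtaLineSharp` does. Sources: KomaTasakiPRL1992 Theorem, footnote [10]; McBryanSpencer1977;
this cell bounds.tex Thm 10⁵. -/
@[conjecture] def MultiFermionEtaLineSharp : Prop :=
  ∀ (n : ℕ) (δ δ' : Fin n → Site 2) (σ σ' : Fin n → Fin 2),
    (∀ i, δ i ∈ insert (0 : Site 2) unitSteps) → (∀ i, δ' i ∈ insert (0 : Site 2) unitSteps) →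
    0 < n → ∀ (t U μ β : ℝ), 0 < |t| → 0 < β → ∀ ε : ℝ, 0 < ε →
    ∃ R : ℝ, ∀ z : Fin 2 → ℤ, R ≤ intNorm z →
      Filter.limsup (fun L : ℕ =>
          ‖(hubbardTorusWith 2 (L + 1) t U μ).thermalCorr β
            (multiFermion δ σ (L + 1) (torusSiteOfInt (L + 1) 0))ᴴ
            (multiFermion δ' σ' (L + 1) (torusSiteOfInt (L + 1) z))‖)
        Filter.atTop ≤ intNorm z ^ (-((1 - ε) * (n : ℝ) ^ 2 / (4 * Real.pi * β * |t|)))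

/-- **`MultiFermionEtaLineSharp` holds**: `norm_thermalCorr_multiFermion_le_sharp` at
`q* = n/(4πβ|t|)` (`f* = n²/(4πβ|t|)`) fed into `exists_limsup_le_rpow` with constant `K(q*)`
and slack `e = ε f*`. -/
theorem multiFermionEtaLineSharp_holds : MultiFermionEtaLineSharp := by
  intro n δ δ' σ σ' hδ hδ' hn t U μ β ht hβ ε hε
  set b : ℝ := β * |t| with hbdef
  have hb0 : 0 < b := mul_pos hβ ht
  have hπ := Real.pi_pos
  have hn1 : (0 : ℝ) < n := by exact_mod_cast hn
  set q : ℝ := n / (4 * Real.pi * b) with hq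
  have hq0 : 0 ≤ q := by positivity
  set fs : ℝ := 2 * n * q - 4 * Real.pi * b * q ^ 2 with hfs
  have hfval : fs = (n : ℝ) ^ 2 / (4 * Real.pi * b) := by
    rw [hfs, hq]
    field_simp
    ring
  have hfpos : 0 < fs := by rw [hfval]; positivity
  have hεf : 0 < ε * fs := by positivity
  set K : ℝ := Real.exp (2 * b *
    (2 * Real.pi * q ^ 2 + 76 * q ^ 2 + 544 * q ^ 4 * Real.exp (2 * q ^ 2))) with hK
  have hK0 : 0 < K := Real.exp_pos _
  obtain ⟨R, hR⟩ := exists_limsup_le_rpow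
    (fun L z => ‖(hubbardTorusWith 2 (L + 1) t U μ).thermalCorr β
        (multiFermion δ σ (L + 1) (torusSiteOfInt (L + 1) 0))ᴴ
        (multiFermion δ' σ' (L + 1) (torusSiteOfInt (L + 1) z))‖)
    K fs (ε * fs) hK0 hfpos hεf (fun L z => norm_nonneg _)
    (fun L z => norm_thermalCorr_multiFermion_le_sharp (L + 1) δ δ' σ σ' hδ hδ' t U μ β q hβ.le
      hq0 hfpos.le (torusSiteOfInt (L + 1) 0) (torusSiteOfInt (L + 1) z))
  refine ⟨R, fun z hz => ?_⟩
  have hexp : -((1 - ε) * (n : ℝ) ^ 2 / (4 * Real.pi * β * |t|)) = -fs + ε * fs := by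
    rw [hfval, hbdef]
    field_simp
    ring
  rw [hexp]
  exact hR z hz

/-! ### The `t–t'` class -/

/-- **Cor 10.4 (t′) (torus form, every `n`-fermion pairing operator of the `t–t'` Hubbard model;
PROVED below).** `H = H_{t,t'}(U) - μN` on `(ℤ/Lℤ)²`, `P_x`, `P'_y` as in
`MultiFermionEtaLineEuclid`; any real `t, t', U, μ`, `β > 0` with `β(|t|+2|t'|) < n²/π`
(temperature `T > (π/n²)(|t|+2|t'|)`; quartets at `t' = -0.2t`: `T > 0.275|t|`): there are
`f > 1/4` and `C` with `|⟨(P_x)† P'_y⟩_{β,L}| ≤ C (dist(x,y)+1)^{-f}` for all `L, x, y`.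
kind: support (PROVED). Why it might fail: it cannot (proved). Sources: KomaTasakiPRL1992
Theorem, note 9, footnote [10]; McBryanSpencer1977; NelsonKosterlitz1977; XuEtAl2024 eq. (1);
this cell bounds.tex Thm 10⁵. -/
@[conjecture] def MultiFermionEtaLineEuclidTPrime : Prop :=
  ∀ (n : ℕ) (δ δ' : Fin n → Site 2) (σ σ' : Fin n → Fin 2),
    (∀ i, δ i ∈ insert (0 : Site 2) unitSteps) → (∀ i, δ' i ∈ insert (0 : Site 2) unitSteps) →
    ∀ (t t' U μ β : ℝ), 0 < β → β * (|t| + 2 * |t'|) < (n : ℝ) ^ 2 / Real.pi →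
    ∃ f C : ℝ, 1 / 4 < f ∧ ∀ (L : ℕ) [NeZero L] (x y : TorusSite 2 L),
      ‖(hubbardTorusTT' L t t' U - (μ : ℂ) • totalNumber).thermalCorr β
          (multiFermion δ σ L x)ᴴ (multiFermion δ' σ' L y)‖ ≤
        C * ((torusDist x y : ℝ) + 1) ^ (-f)

/-- **`MultiFermionEtaLineEuclidTPrime` holds** (`b = β(|t|+2|t'|)`; witness `q` of
`exists_exponent_gt_quarter`, `C = K_{t,t'}(q) 5^f`). -/
theorem multiFermionEtaLineEuclidTPrime_holds : MultiFermionEtaLineEuclidTPrime := by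
  intro n δ δ' σ σ' hδ hδ' t t' U μ β hβ hb
  have hb0 : 0 ≤ β * (|t| + 2 * |t'|) := by positivity
  obtain ⟨q, hq0, hf4⟩ := exists_exponent_gt_quarter hb0 hb
  refine ⟨2 * n * q - 4 * Real.pi * (β * (|t| + 2 * |t'|)) * q ^ 2,
    Real.exp (2 * β * (|t| * (2 * Real.pi * q ^ 2 + 76 * q ^ 2 +
        544 * q ^ 4 * Real.exp (2 * q ^ 2)) +
      |t'| * (4 * Real.pi * q ^ 2 + 289 * q ^ 2 + 3402 * q ^ 4 * Real.exp (2 * q ^ 2)))) *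
      (5 : ℝ) ^ (2 * n * q - 4 * Real.pi * (β * (|t| + 2 * |t'|)) * q ^ 2), hf4,
    fun L _ x y => ?_⟩
  rw [mul_assoc]
  exact norm_thermalCorr_multiFermion_ttPrime_le_sharp L δ δ' σ σ' hδ hδ' t t' U μ β q hβ.le hq0
    (by linarith) x y

/-- **Thm 10⁵ (t′) (the sharp exponent for `n`-fermion pairing operators of the `t–t'` model;
PROVED below).** For `n ≥ 1`, steps in `{0, ±e₁, ±e₂}`, arbitrary spins, all real `U, μ`,
`|t| + 2|t'| > 0`, `β > 0` and `ε > 0` there is `R` such that for every `z ∈ ℤ²` with `|z| ≥ R`,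
`limsup_{L→∞} |⟨(P_0)† P'_z⟩_{β,L+1}| ≤ |z|^{-(1-ε)n²/(4πβ(|t|+2|t'|))}`. kind: support (PROVED).
Why it might fail: it cannot (proved). Sources: KomaTasakiPRL1992 Theorem, note 9,
footnote [10]; McBryanSpencer1977; XuEtAl2024 eq. (1); this cell bounds.tex Thm 10⁵. -/
@[conjecture] def MultiFermionEtaLineSharpTPrime : Prop :=
  ∀ (n : ℕ) (δ δ' : Fin n → Site 2) (σ σ' : Fin n → Fin 2),
    (∀ i, δ i ∈ insert (0 : Site 2) unitSteps) → (∀ i, δ' i ∈ insert (0 : Site 2) unitSteps) →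
    0 < n → ∀ (t t' U μ β : ℝ), 0 < |t| + 2 * |t'| → 0 < β → ∀ ε : ℝ, 0 < ε →
    ∃ R : ℝ, ∀ z : Fin 2 → ℤ, R ≤ intNorm z →
      Filter.limsup (fun L : ℕ =>
          ‖(hubbardTorusTT' (L + 1) t t' U - (μ : ℂ) • totalNumber).thermalCorr β
            (multiFermion δ σ (L + 1) (torusSiteOfInt (L + 1) 0))ᴴ
            (multiFermion δ' σ' (L + 1) (torusSiteOfInt (L + 1) z))‖)
        Filter.atTop ≤
          intNorm z ^ (-((1 - ε) * (n : ℝ) ^ 2 / (4 * Real.pi * β * (|t| + 2 * |t'|))))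

/-- **`MultiFermionEtaLineSharpTPrime` holds**: `norm_thermalCorr_multiFermion_ttPrime_le_sharp`
at `q* = n/(4πβ(|t|+2|t'|))` fed into `exists_limsup_le_rpow` with constant `K_{t,t'}(q*)` and
slack `e = ε f*`. -/
theorem multiFermionEtaLineSharpTPrime_holds : MultiFermionEtaLineSharpTPrime := by
  intro n δ δ' σ σ' hδ hδ' hn t t' U μ β htt hβ ε hε
  set b : ℝ := β * (|t| + 2 * |t'|) with hbdef
  have hb0 : 0 < b := mul_pos hβ htt
  have hπ := Real.pi_pos
  have hn1 : (0 : ℝ) < n := by exact_mod_cast hn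
  set q : ℝ := n / (4 * Real.pi * b) with hq
  have hq0 : 0 ≤ q := by positivity
  set fs : ℝ := 2 * n * q - 4 * Real.pi * b * q ^ 2 with hfs
  have hfval : fs = (n : ℝ) ^ 2 / (4 * Real.pi * b) := by
    rw [hfs, hq]
    field_simp
    ring
  have hfpos : 0 < fs := by rw [hfval]; positivity
  have hεf : 0 < ε * fs := by positivity
  set K : ℝ := Real.exp (2 * β * (|t| * (2 * Real.pi * q ^ 2 + 76 * q ^ 2 +
      544 * q ^ 4 * Real.exp (2 * q ^ 2)) +
    |t'| * (4 * Real.pi * q ^ 2 + 289 * q ^ 2 + 3402 * q ^ 4 * Real.exp (2 * q ^ 2)))) with hK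
  have hK0 : 0 < K := Real.exp_pos _
  obtain ⟨R, hR⟩ := exists_limsup_le_rpow
    (fun L z => ‖(hubbardTorusTT' (L + 1) t t' U - (μ : ℂ) • totalNumber).thermalCorr β
        (multiFermion δ σ (L + 1) (torusSiteOfInt (L + 1) 0))ᴴ
        (multiFermion δ' σ' (L + 1) (torusSiteOfInt (L + 1) z))‖)
    K fs (ε * fs) hK0 hfpos hεf (fun L z => norm_nonneg _)
    (fun L z => norm_thermalCorr_multiFermion_ttPrime_le_sharp (L + 1) δ δ' σ σ' hδ hδ' t t' U μ
      β q hβ.le hq0 hfpos.le (torusSiteOfInt (L + 1) 0) (torusSiteOfInt (L + 1) z))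
  refine ⟨R, fun z hz => ?_⟩
  have hexp : -((1 - ε) * (n : ℝ) ^ 2 / (4 * Real.pi * β * (|t| + 2 * |t'|))) = -fs + ε * fs := by
    rw [hfval, hbdef]
    field_simp
    ring
  rw [hexp]
  exact hR z hz

/-! ### Electron quartets (charge `4e`): the bond quartet `c_{x↑} c_{x↓} c_{x+e₁,↑} c_{x+e₁,↓}` -/

/-- The steps `(0, 0, e₁, e₁)` of the bond quartet `Q_x = c_{x↑} c_{x↓} c_{x+e₁,↑} c_{x+e₁,↓}`
(two on-site pairs on the bond `(x, x+e₁)`; charge `4e`). -/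
def bondQuartetSteps : Fin 4 → Site 2 := ![0, 0, Pi.single 0 1, Pi.single 0 1]

/-- The spins `(↑, ↓, ↑, ↓)` of the bond quartet. -/
def bondQuartetSpins : Fin 4 → Fin 2 := ![0, 1, 0, 1]

/-- The bond quartet's steps lie in `{0, ±e₁, ±e₂}`. -/
theorem bondQuartetSteps_mem (i : Fin 4) : bondQuartetSteps i ∈ insert (0 : Site 2) unitSteps := by
  fin_cases i <;> simp [bondQuartetSteps, unitSteps]

/-- **Charge-`4e` quartets, torus form**: for `T > π|t|/16 ≈ 0.196|t|` there are `f > 1/4` and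
`C` with `|⟨(Q_x)† Q_y⟩_{β,L}| ≤ C (dist(x,y)+1)^{-f}` for all `L, x, y`
(`Q_x = c_{x↑} c_{x↓} c_{x+e₁,↑} c_{x+e₁,↓}`); every `U`, `μ` of the nearest-neighbour Hubbard
model — no charge-`4e` quasi-long-range order with `η ≤ 1/4` above `π|t|/16`. -/
theorem bondQuartet_decay_torus (t U μ β : ℝ) (hβ : 0 < β) (hb : β * |t| < 16 / Real.pi) :
    ∃ f C : ℝ, 1 / 4 < f ∧ ∀ (L : ℕ) [NeZero L] (x y : TorusSite 2 L),
      ‖(hubbardTorusWith 2 L t U μ).thermalCorr β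
          (multiFermion bondQuartetSteps bondQuartetSpins L x)ᴴ
          (multiFermion bondQuartetSteps bondQuartetSpins L y)‖ ≤
        C * ((torusDist x y : ℝ) + 1) ^ (-f) :=
  multiFermionEtaLineEuclid_holds 4 bondQuartetSteps bondQuartetSteps bondQuartetSpins
    bondQuartetSpins bondQuartetSteps_mem bondQuartetSteps_mem t U μ β hβ (by norm_num; exact hb)

/-- **Charge-`4e` quartets, thermodynamic-limit form**: for `t ≠ 0`, `β > 0`, `ε > 0` and
`|z| ≥ R(ε)`, `limsup_{L→∞} |⟨(Q_0)† Q_z⟩_{β,L+1}| ≤ |z|^{-(1-ε)·4T/(π|t|)}` — the quartet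
exponent `η₄(T) ≥ 4T/(π|t|)`, four times the pair exponent; every `U`, `μ`. -/
theorem bondQuartet_limsup_le_rpow (t U μ β : ℝ) (ht : 0 < |t|) (hβ : 0 < β) (ε : ℝ)
    (hε : 0 < ε) :
    ∃ R : ℝ, ∀ z : Fin 2 → ℤ, R ≤ intNorm z →
      Filter.limsup (fun L : ℕ =>
          ‖(hubbardTorusWith 2 (L + 1) t U μ).thermalCorr β
            (multiFermion bondQuartetSteps bondQuartetSpins (L + 1) (torusSiteOfInt (L + 1) 0))ᴴ
            (multiFermion bondQuartetSteps bondQuartetSpins (L + 1)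
              (torusSiteOfInt (L + 1) z))‖)
        Filter.atTop ≤ intNorm z ^ (-((1 - ε) * 4 / (Real.pi * β * |t|))) := by
  obtain ⟨R, hR⟩ := multiFermionEtaLineSharp_holds 4 bondQuartetSteps bondQuartetSteps
    bondQuartetSpins bondQuartetSpins bondQuartetSteps_mem bondQuartetSteps_mem (by norm_num)
    t U μ β ht hβ ε hε
  refine ⟨R, fun z hz => ?_⟩
  have h := hR z hz
  have he : -((1 - ε) * ((4 : ℕ) : ℝ) ^ 2 / (4 * Real.pi * β * |t|)) =
      -((1 - ε) * 4 / (Real.pi * β * |t|)) := by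
    have hπ := Real.pi_pos
    have hD : Real.pi * β * |t| ≠ 0 := (mul_pos (mul_pos hπ hβ) ht).ne'
    have hD4 : 4 * Real.pi * β * |t| ≠ 0 :=
      (mul_pos (mul_pos (mul_pos (by norm_num) hπ) hβ) ht).ne'
    push_cast
    rw [neg_inj, div_eq_div_iff hD4 hD]
    ring
  rw [he] at h
  exact h

/-- **Charge-`4e` quartets in the `t–t'` model, torus form**: for `T > (π/16)(|t|+2|t'|)`
(`= 0.275|t|` at `t' = -0.2t`) there are `f > 1/4`, `C` with
`|⟨(Q_x)† Q_y⟩_{β,L}| ≤ C (dist(x,y)+1)^{-f}` for all `L, x, y`; every `U`, `μ`. -/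
theorem bondQuartet_ttPrime_decay_torus (t t' U μ β : ℝ) (hβ : 0 < β)
    (hb : β * (|t| + 2 * |t'|) < 16 / Real.pi) :
    ∃ f C : ℝ, 1 / 4 < f ∧ ∀ (L : ℕ) [NeZero L] (x y : TorusSite 2 L),
      ‖(hubbardTorusTT' L t t' U - (μ : ℂ) • totalNumber).thermalCorr β
          (multiFermion bondQuartetSteps bondQuartetSpins L x)ᴴ
          (multiFermion bondQuartetSteps bondQuartetSpins L y)‖ ≤
        C * ((torusDist x y : ℝ) + 1) ^ (-f) :=
  multiFermionEtaLineEuclidTPrime_holds 4 bondQuartetSteps bondQuartetSteps bondQuartetSpins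
    bondQuartetSpins bondQuartetSteps_mem bondQuartetSteps_mem t t' U μ β hβ
    (by norm_num; exact hb)

/-- **Charge-`4e` quartets in the `t–t'` model, thermodynamic-limit form**: for
`|t| + 2|t'| > 0`, `β > 0`, `ε > 0` and `|z| ≥ R(ε)`,
`limsup_{L→∞} |⟨(Q_0)† Q_z⟩_{β,L+1}| ≤ |z|^{-(1-ε)·4T/(π(|t|+2|t'|))}`; every `U`, `μ`. -/
theorem bondQuartet_ttPrime_limsup_le_rpow (t t' U μ β : ℝ) (htt : 0 < |t| + 2 * |t'|)
    (hβ : 0 < β) (ε : ℝ) (hε : 0 < ε) :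
    ∃ R : ℝ, ∀ z : Fin 2 → ℤ, R ≤ intNorm z →
      Filter.limsup (fun L : ℕ =>
          ‖(hubbardTorusTT' (L + 1) t t' U - (μ : ℂ) • totalNumber).thermalCorr β
            (multiFermion bondQuartetSteps bondQuartetSpins (L + 1) (torusSiteOfInt (L + 1) 0))ᴴ
            (multiFermion bondQuartetSteps bondQuartetSpins (L + 1)
              (torusSiteOfInt (L + 1) z))‖)
        Filter.atTop ≤ intNorm z ^ (-((1 - ε) * 4 / (Real.pi * β * (|t| + 2 * |t'|)))) := by
  obtain ⟨R, hR⟩ := multiFermionEtaLineSharpTPrime_holds 4 bondQuartetSteps bondQuartetSteps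
    bondQuartetSpins bondQuartetSpins bondQuartetSteps_mem bondQuartetSteps_mem (by norm_num)
    t t' U μ β htt hβ ε hε
  refine ⟨R, fun z hz => ?_⟩
  have h := hR z hz
  have he : -((1 - ε) * ((4 : ℕ) : ℝ) ^ 2 / (4 * Real.pi * β * (|t| + 2 * |t'|))) =
      -((1 - ε) * 4 / (Real.pi * β * (|t| + 2 * |t'|))) := by
    have hπ := Real.pi_pos
    have hD : Real.pi * β * (|t| + 2 * |t'|) ≠ 0 := (mul_pos (mul_pos hπ hβ) htt).ne'
    have hD4 : 4 * Real.pi * β * (|t| + 2 * |t'|) ≠ 0 :=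
      (mul_pos (mul_pos (mul_pos (by norm_num) hπ) hβ) htt).ne'
    push_cast
    rw [neg_inj, div_eq_div_iff hD4 hD]
    ring
  rw [he] at h
  exact h

end Summit.HubbardSuperconductivity.HubbardLadder.Bounds

end
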